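import Mathlib.Data.Fintype.Vector
import Literature.Computability.Complexity.Oracle
import HarnessLib

/-!
# Aaronson–Ambainis' heuristic class `AvgP` relative to an oracle (`AvgPRel`)

S. Aaronson, A. Ambainis, *The need for structure in quantum speedups*, Theory Comput. 10 (2014)
133–166 (arXiv:0911.0996v3) [AaronsonAmbainis2014], §1 (p. 5): "`AvgP` is the class of languages
for which there exists a polynomial-time algorithm that solves a `1 − o(1)` fraction of instances
of size `n`"; relative to an oracle `A` this is the class `AvgP^A` of their Thm. 7 (iii) / Thm. 23
("if `P = P^{#P}`, then `BQP^A ⊂ AvgP^A` with probability `1` for a random oracle `A`").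

* `errFraction L f n` — the fraction of `x ∈ {0,1}ⁿ` on which the answer `f x` differs from
  `[x ∈ L]` (`none`, i.e. no output within the round budget, counts as an error);
  `errFraction_nonneg`, `errFraction_le_one`, `errFraction_eq_zero_of_correct`.
* `AvgPRel O` = `AvgP^O`: languages answered correctly by some polynomial-time oracle machine —
  G01's transcript model `OracleAlg` with a polynomial round budget and polynomially bounded
  queries, literally as in `PRel` — on a `1 − o(1)` fraction of the inputs of each length
  ("solves a `1 − o(1)` fraction" = `errFraction → 0`, `Filter.Tendsto … atTop (𝓝 0)`). This is
  a HEURISTIC class (the machine may err on the remaining inputs), NOT the relativization of the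
  errorless class `Literature.Computability.MetaComplexity.AvgP` of Bogdanov–Trevisan (whose
  machines never err but may time out on a small measure of inputs).
* `PRel_subset_AvgPRel`: `P^O ⊆ AvgP^O`.

## Why this module exists (fact-free home)

It imports `Complexity/Oracle.lean` (and through it the class files) only — no oracle-separation
fact, no barrier entry, no conjecture — so a route thesis stating "`BQP^A ⊆ AvgP^A` with
probability `1` over the random oracle `A`" by name imports this file,
`Literature.Computability.QuantumComplexity.RandomOracleMeasure` and
`Literature.Computability.Cryptography.ClassBQP`, and carries none of `yamakawa_zhandry`,
`AAConjecture`, `QuantumQuerySimulable` in its module cone. The older spellings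
`Literature.Barriers.QuantumAdvantage.errFraction` / `….AvgPRel` / `….PRel_subset_AvgPRel` of the
barrier entry `Barriers/QuantumAdvantage/RandomOracleMethod.lean` (where the vocabulary was first
written down, next to the printed facts `fortnowRogers1999_thm44`, `aaronsonAmbainis2014_thm7iii`)
denote the same objects: that file imports this one and keeps them as reducible synonyms, so the
two spellings of any statement are definitionally equal (reducibly) and the proof of Thm. 7 (iii)
over the old spelling (`RandomOracleMethodThm23.lean`, `RandomOracleMethodHolds.lean`) applies to
either. (The names could not simply be moved: the gate pins a fully-qualified name to the module
that first declared it, and the old ones have importers.)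

## Sources

[AaronsonAmbainis2014] arXiv:0911.0996v3: §1 p. 5 (AvgP, the quoted sentence), Thm. 7 (pp. 5–6),
Thm. 23 (p. 14, the proof: a deterministic polynomial-time `C` with error fraction `≤ 1/n` for
all but finitely many `n`, with probability `1` over `A`).
-/

noncomputable section

namespace Literature.Computability.Complexity

open _root_.Computability Filter

/-! ### The error fraction of an answer function -/

/-- The error fraction at length `n` of an answer function `f` for the language `L`: the
proportion of `x ∈ {0,1}ⁿ` with `f x ≠ some [x ∈ L]` (no answer, `none`, counts as an error).
[cite: AaronsonAmbainis2014, §1 (p. 5, AvgP: solves a 1 − o(1) fraction of instances of size n)] -/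
def errFraction (L : Language Bool) (f : List Bool → Option Bool) (n : ℕ) : ℝ :=
  ((Finset.univ.filter fun x : List.Vector Bool n =>
      f x.toList ≠ some (L.boolIndicator x.toList)).card : ℝ) / 2 ^ n

/-- The error fraction is nonnegative. [folklore] -/
theorem errFraction_nonneg (L : Language Bool) (f : List Bool → Option Bool) (n : ℕ) :
    0 ≤ errFraction L f n :=
  div_nonneg (Nat.cast_nonneg _) (by positivity)

/-- The error fraction is at most `1` (there are `2ⁿ` inputs of length `n`). [folklore] -/
theorem errFraction_le_one (L : Language Bool) (f : List Bool → Option Bool) (n : ℕ) :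
    errFraction L f n ≤ 1 := by
  unfold errFraction
  rw [div_le_one (by positivity)]
  have h := Finset.card_le_univ
    (Finset.univ.filter fun x : List.Vector Bool n => f x.toList ≠ some (L.boolIndicator x.toList))
  rw [card_vector, Fintype.card_bool] at h
  exact_mod_cast h

/-- A correct answer function has error fraction `0`. [folklore] -/
theorem errFraction_eq_zero_of_correct {L : Language Bool} {f : List Bool → Option Bool}
    (h : ∀ x, f x = some (L.boolIndicator x)) (n : ℕ) : errFraction L f n = 0 := by
  unfold errFraction
  rw [Finset.card_eq_zero.mpr]
  · simp
  · exact Finset.filter_eq_empty_iff.mpr fun x _ hx => hx (h _)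

/-! ### `AvgP` relative to an oracle -/

/-- `AvgPRel O = AvgP^O` (Aaronson–Ambainis): the languages `L` for which some polynomial-time
oracle machine with oracle `O` (G01 transcript model `OracleAlg`, polynomial round budget and
query length, as in `PRel`) answers `[x ∈ L]` on a `1 − o(1)` fraction of the inputs of each
length `n`, i.e. with error fraction tending to `0`. A HEURISTIC class (the machine may err),
not the relativization of the errorless `Literature.Computability.MetaComplexity.AvgP`.
[cite: AaronsonAmbainis2014, §1 (p. 5, definition of AvgP) and Thm. 23 (proof)] -/
def AvgPRel (O : Oracle) : Set (Language Bool) :=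
  {L | ∃ M : OracleAlg Bool, M.IsPolyTime encodingBoolBool ∧ ∃ q : Polynomial ℕ,
    (∀ x : List Bool, ∀ y ∈ M.queries O (q.eval x.length) x, y.length ≤ q.eval x.length) ∧
      Tendsto (fun n => errFraction L (fun x => M.run O (q.eval x.length) x) n) atTop (nhds 0)}

/-- Membership in `AvgP^O`, unfolded. [folklore] -/
theorem mem_AvgPRel_iff {O : Oracle} {L : Language Bool} :
    L ∈ AvgPRel O ↔ ∃ M : OracleAlg Bool, M.IsPolyTime encodingBoolBool ∧ ∃ q : Polynomial ℕ,
      (∀ x : List Bool, ∀ y ∈ M.queries O (q.eval x.length) x, y.length ≤ q.eval x.length) ∧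
        Tendsto (fun n => errFraction L (fun x => M.run O (q.eval x.length) x) n) atTop (nhds 0) :=
  Iff.rfl

/-- `P^O ⊆ AvgP^O` (a machine that is always right errs on a `0` fraction). [folklore] -/
theorem PRel_subset_AvgPRel (O : Oracle) : PRel O ⊆ AvgPRel O := by
  rintro L ⟨M, hM, q, h⟩
  refine ⟨M, hM, q, fun x => (h x).2, ?_⟩
  have h0 : (fun n => errFraction L (fun x => M.run O (q.eval x.length) x) n) = fun _ => 0 :=
    funext fun n => errFraction_eq_zero_of_correct (fun x => (h x).1) n
  rw [h0]
  exact tendsto_const_nhds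

end Literature.Computability.Complexity

end
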